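import Literature.NumberTheory.LFunctions.XiTiltedNormaliser
import Literature.NumberTheory.LFunctions.DeBruijnPhiLogDerivEnvelope
import HarnessLib

/-!
# The ladder tail lemma for `ξ`: analytic inputs (mode bracket and left mass of `u^kΦ(u)du`)

`Literature/NumberTheory/LFunctions/`. Two inputs of the Jensen track's THEOREM A (eng-3, LADDER-BL.md
§4; design HOME/jensen/p1/THEOREM-A-ASSEMBLY.md) for the tilted laws `ν_k ∝ u^kΦ(u)du` with potential
`W_k = −(k log u + log Φ)`:

* `exists_xi_mode_ge`: if `4πe^{4α₀} − 9 < k/α₀` then `W_k` has a critical point `a ≥ α₀` (IVT between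
  `α₀`, where `W_k′ < 0` by the upper envelope `−Φ′/Φ ≤ 4πe^{4u} − 9`, and `k + 2`, where `W_k′ > 0` by
  the lower envelope; `DeBruijnPhiLogDerivEnvelope.lean`);
* `xi_leftMass_le`: for a critical point `a`, a cut `b = a − τ` and a window `s` with `3/2 ≤ a − s`,
  `(∫₀^{a−τ} u^kΦ)/M_k ≤ e^{−Rτ²/2}·e^{Λs²/2}/(2sRτ)` with the bulk floor `R = 16πe^{4(a−τ)}` and the
  window ceiling `Λ = k/(a−s)² + 16πe^{4(a+s)}(1+10⁻⁶)` — the one-sided convexity tail of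
  `ConvexPotentialTails.lean` over the window normaliser of `XiTiltedNormaliser.lean`;
* `xi_curvature_lower`: `16πe^{4u} < W_k″(u)` (`deBruijnPhi_logConcave_quantitative`).

The potential vocabulary (`xiPotential`, `xiMode`, …) lives in `XiTiltedPotential.lean`; here the
hypotheses are written out (`k/a + Φ′(a)/Φ(a) = 0` for "`a` is a critical point") and the calculus facts
are private helpers. Consumer: `XiLadderMuTwo.lean` (`μ₂(n) ≤ 3/20` for `n ≥ 10⁵`).

References: Griffin–Ono–Rolen–Zagier, PNAS 116 (2019), Thm 7 / §5.1 [GORZPNAS2019]; Coffey–Csordas,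
Math. Comp. 82 (2013), Thm 2.4 [CoffeyCsordas2013].
-/

noncomputable section

open MeasureTheory Set Filter
open scoped Topology

namespace Literature.NumberTheory.LFunctions

open Literature.Probability.Distributions

/-! ### Private calculus helpers for `W_k = −(k log u + log Φ)` -/

/-- `e^{−W_k(u)} = Φ(u)u^k` on `(0, ∞)`. [folklore] -/
private theorem exp_neg_W (k : ℕ) {u : ℝ} (hu : 0 < u) :
    Real.exp (-(-((k : ℝ) * Real.log u + Real.log (deBruijnPhi u)))) = deBruijnPhi u * u ^ k := by
  rw [neg_neg, Real.exp_add, Real.exp_nat_mul, Real.exp_log hu,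
    Real.exp_log (deBruijnPhi_pos_holds u)]
  ring

/-- `W_k′ = −(k/u + Φ′/Φ)` on `(0, ∞)`. [folklore] -/
private theorem hasDerivAt_W (k : ℕ) {u : ℝ} (hu : 0 < u) :
    HasDerivAt (fun t => -((k : ℝ) * Real.log t + Real.log (deBruijnPhi t)))
      (-((k : ℝ) / u + deBruijnPhiDeriv u / deBruijnPhi u)) u := by
  have h1 : HasDerivAt (fun t => (k : ℝ) * Real.log t) ((k : ℝ) * u⁻¹) u :=
    (Real.hasDerivAt_log hu.ne').const_mul _
  have h : HasDerivAt (fun t => -((k : ℝ) * Real.log t + Real.log (deBruijnPhi t)))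
      (-((k : ℝ) * u⁻¹ + deBruijnPhiDeriv u / deBruijnPhi u)) u :=
    (h1.add (hasDerivAt_log_deBruijnPhi u)).neg
  exact h.congr_deriv (by simp only [div_eq_mul_inv])

/-- `W_k″ = k/u² + (Φ′² − ΦΦ″)/Φ²` on `(0, ∞)`. [folklore] -/
private theorem hasDerivAt_W' (k : ℕ) {u : ℝ} (hu : 0 < u) :
    HasDerivAt (fun t => -((k : ℝ) / t + deBruijnPhiDeriv t / deBruijnPhi t))
      ((k : ℝ) / u ^ 2 +
        (deBruijnPhiDeriv u ^ 2 - deBruijnPhi u * deBruijnPhiDeriv₂ u) / deBruijnPhi u ^ 2) u := by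
  have h1 : HasDerivAt (fun t => (k : ℝ) / t) ((0 * u - (k : ℝ) * 1) / u ^ 2) u :=
    (hasDerivAt_const u (k : ℝ)).div (hasDerivAt_id' u) hu.ne'
  have h : HasDerivAt (fun t => -((k : ℝ) / t + deBruijnPhiDeriv t / deBruijnPhi t))
      (-((0 * u - (k : ℝ) * 1) / u ^ 2 +
        (deBruijnPhiDeriv₂ u * deBruijnPhi u - deBruijnPhiDeriv u * deBruijnPhiDeriv u) /
          deBruijnPhi u ^ 2)) u := (h1.add (hasDerivAt_deriv_log_deBruijnPhi u)).neg
  refine h.congr_deriv ?_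
  have hΦ := (deBruijnPhi_pos_holds u).ne'
  have hu' := hu.ne'
  field_simp
  ring

/-- **Curvature of the tilted potential from below**: `16πe^{4u} < k/u² + (Φ′² − ΦΦ″)/Φ² = W_k″(u)`
for `u > 0` (Coffey–Csordas log-concavity in the quantitative form `deBruijnPhi_logConcave_quantitative`).
[cite: CoffeyCsordas2013, Theorem 2.4 (proof)] -/
theorem xi_curvature_lower (k : ℕ) {u : ℝ} (hu : 0 < u) :
    16 * Real.pi * Real.exp (4 * u) <
      (k : ℝ) / u ^ 2 +
        (deBruijnPhiDeriv u ^ 2 - deBruijnPhi u * deBruijnPhiDeriv₂ u) / deBruijnPhi u ^ 2 := by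
  have h := deBruijnPhi_logConcave_quantitative u
  rw [abs_of_pos hu] at h
  have hΦ := pow_pos (deBruijnPhi_pos_holds u) 2
  have h1 : 16 * Real.pi * Real.exp (4 * u) <
      (deBruijnPhiDeriv u ^ 2 - deBruijnPhi u * deBruijnPhiDeriv₂ u) / deBruijnPhi u ^ 2 := by
    rw [lt_div_iff₀ hΦ]; linarith
  have h2 : 0 ≤ (k : ℝ) / u ^ 2 := by positivity
  linarith

/-- `W_k` is convex on `(0, ∞)`. [folklore] -/
private theorem convexOn_W (k : ℕ) :
    ConvexOn ℝ (Ioi 0) (fun t => -((k : ℝ) * Real.log t + Real.log (deBruijnPhi t))) := by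
  set g : ℝ → ℝ := fun t => -((k : ℝ) * Real.log t + Real.log (deBruijnPhi t)) with hg
  set g₁ : ℝ → ℝ := fun t => -((k : ℝ) / t + deBruijnPhiDeriv t / deBruijnPhi t) with hg₁
  set g₂ : ℝ → ℝ := fun t => (k : ℝ) / t ^ 2 +
    (deBruijnPhiDeriv t ^ 2 - deBruijnPhi t * deBruijnPhiDeriv₂ t) / deBruijnPhi t ^ 2 with hg₂
  have hgd : ∀ x ∈ Ioi (0 : ℝ), HasDerivAt g (g₁ x) x := fun x hx => hasDerivAt_W k hx
  have hg₁d : ∀ x ∈ Ioi (0 : ℝ), HasDerivAt g₁ (g₂ x) x := fun x hx => hasDerivAt_W' k hx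
  have hint : interior (Ioi (0 : ℝ)) = Ioi 0 := interior_Ioi
  have hderiv : ∀ x ∈ Ioi (0 : ℝ), deriv g x = g₁ x := fun x hx => (hgd x hx).deriv
  refine convexOn_of_deriv2_nonneg (convex_Ioi 0)
    (fun x hx => (hgd x hx).continuousAt.continuousWithinAt) ?_ ?_ ?_
  · rw [hint]; exact fun x hx => (hgd x hx).differentiableAt.differentiableWithinAt
  · rw [hint]
    have h : DifferentiableOn ℝ g₁ (Ioi 0) :=
      fun x hx => (hg₁d x hx).differentiableAt.differentiableWithinAt
    exact h.congr fun x hx => hderiv x hx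
  · rw [hint]
    intro x hx
    have heq : deriv g =ᶠ[𝓝 x] g₁ :=
      Filter.eventuallyEq_of_mem (Ioi_mem_nhds hx) fun y hy => hderiv y hy
    rw [Function.iterate_succ_apply, Function.iterate_one, heq.deriv_eq, (hg₁d x hx).deriv]
    exact (lt_trans (by positivity) (xi_curvature_lower k hx)).le

/-! ### Step A: the mode lies above `α₀` -/

/-- If `4πe^{4α₀} − 9 < k/α₀` (`α₀ > 0`) then `W_k` has a critical point `a ≥ α₀`
(IVT between `α₀`, where `W_k′ < 0` by the upper envelope of `−Φ′/Φ`, and `k + 2`, where `W_k′ > 0`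
by the lower envelope). [cite: GORZPNAS2019, Thm 7 and §5.1] -/
theorem exists_xi_mode_ge (k : ℕ) {α₀ : ℝ} (hα : 0 < α₀)
    (hk : 4 * Real.pi * Real.exp (4 * α₀) - 9 < (k : ℝ) / α₀) :
    ∃ a : ℝ, α₀ ≤ a ∧ (k : ℝ) / a + deBruijnPhiDeriv a / deBruijnPhi a = 0 := by
  set f : ℝ → ℝ := fun u => (k : ℝ) / u + deBruijnPhiDeriv u / deBruijnPhi u with hf
  have hk0 : (0 : ℝ) ≤ k := Nat.cast_nonneg k
  set u₁ : ℝ := (k : ℝ) + 2 with hu₁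
  have hu₁pos : 0 < u₁ := by positivity
  have hαu : α₀ ≤ u₁ := by
    -- `α₀ < k + 2`: from `hk`, `k/α₀ > 4πe^{4α₀} − 9 ≥ 4π(1 + 4α₀) − 9 > 0`, fine either way via cases
    by_contra h
    push Not at h
    -- then `k/α₀ < 1`, contradicting `hk` since `4πe^{4α₀} − 9 > 4π − 9 > 1`
    have h1 : (k : ℝ) / α₀ < 1 := by
      rw [div_lt_one hα]; linarith
    have h2 : (1 : ℝ) ≤ Real.exp (4 * α₀) := Real.one_le_exp (by linarith)
    have hπ := Real.pi_gt_three
    nlinarith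
  -- values at the endpoints
  have hfa : 0 < f α₀ := by
    have henv := neg_deBruijnPhiDeriv_div_le hα.le
    have : deBruijnPhiDeriv α₀ / deBruijnPhi α₀ = -(-deBruijnPhiDeriv α₀ / deBruijnPhi α₀) := by ring
    simp only [hf]; rw [this]; linarith
  have hfb : f u₁ < 0 := by
    have hu32 : (3 : ℝ) / 2 ≤ u₁ := by rw [hu₁]; linarith
    have henv := le_neg_deBruijnPhiDeriv_div hu32
    have h1 : (k : ℝ) / u₁ ≤ 1 := by
      rw [div_le_one hu₁pos, hu₁]; linarith
    have h2 : 4 * u₁ + 1 ≤ Real.exp (4 * u₁) := Real.add_one_le_exp _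
    have hπ := Real.pi_gt_three
    have : deBruijnPhiDeriv u₁ / deBruijnPhi u₁ = -(-deBruijnPhiDeriv u₁ / deBruijnPhi u₁) := by ring
    simp only [hf]; rw [this]
    nlinarith
  -- continuity on `[α₀, u₁] ⊆ (0, ∞)` and IVT
  have hcont : ContinuousOn f (Icc α₀ u₁) := by
    have hsub : Icc α₀ u₁ ⊆ Ioi (0 : ℝ) := fun u hu => lt_of_lt_of_le hα hu.1
    refine ContinuousOn.add ?_ ?_
    · exact continuousOn_const.div continuousOn_id fun x hx => (hsub hx).ne'
    · exact (continuous_deBruijnPhiDeriv.continuousOn.div continuous_deBruijnPhi.continuousOn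
        fun x _ => (deBruijnPhi_pos_holds x).ne')
  obtain ⟨a, ha, hfa0⟩ := intermediate_value_Icc' hαu hcont ⟨hfb.le, hfa.le⟩
  exact ⟨a, ha.1, hfa0⟩

/-! ### Step C: the left mass below the cut is negligible -/

/-- **Left mass bound.** For a critical point `a` of `W_k` with `a − τ ≥ 3/2 + s`… precisely: for
`0 < s`, `0 < τ`, `3/2 ≤ a − s`, `τ < a`, with `R = 16πe^{4(a−τ)}` and
`Λ = k/(a−s)² + 16πe^{4(a+s)}(1 + 10⁻⁶)`:
`(∫₀^{a−τ} u^kΦ)/M_k ≤ e^{−Rτ²/2}·e^{Λs²/2}/(2sRτ)`.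
[cite: GORZPNAS2019, Thm 7 and §5.1] -/
theorem xi_leftMass_le (k : ℕ) {a s τ : ℝ} (hs : 0 < s) (hτ : 0 < τ) (has : 3 / 2 ≤ a - s)
    (hτa : τ < a) (hmode : (k : ℝ) / a + deBruijnPhiDeriv a / deBruijnPhi a = 0) :
    (∫ u in Ioo 0 (a - τ), deBruijnPhi u * u ^ k) / xiMoment k ≤
      Real.exp (-(16 * Real.pi * Real.exp (4 * (a - τ)) * τ ^ 2 / 2)) *
        Real.exp (((k : ℝ) / (a - s) ^ 2 + 16 * Real.pi * Real.exp (4 * (a + s)) * (1 + 1 / 10 ^ 6)) *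
          s ^ 2 / 2) /
        (2 * s * (16 * Real.pi * Real.exp (4 * (a - τ))) * τ) := by
  set g : ℝ → ℝ := fun t => -((k : ℝ) * Real.log t + Real.log (deBruijnPhi t)) with hg
  set g₁ : ℝ → ℝ := fun t => -((k : ℝ) / t + deBruijnPhiDeriv t / deBruijnPhi t) with hg₁
  set g₂ : ℝ → ℝ := fun t => (k : ℝ) / t ^ 2 +
    (deBruijnPhiDeriv t ^ 2 - deBruijnPhi t * deBruijnPhiDeriv₂ t) / deBruijnPhi t ^ 2 with hg₂
  set R : ℝ := 16 * Real.pi * Real.exp (4 * (a - τ)) with hR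
  set Λ : ℝ := (k : ℝ) / (a - s) ^ 2 + 16 * Real.pi * Real.exp (4 * (a + s)) * (1 + 1 / 10 ^ 6)
    with hΛ
  set b : ℝ := a - τ with hb
  have ha : 0 < a := by linarith
  have hsa : s < a := by linarith
  have hb0 : 0 < b := by rw [hb]; linarith
  have hba : b < a := by rw [hb]; linarith
  have hR0 : 0 < R := by positivity
  have hga : g₁ a = 0 := by simp only [hg₁, hmode, neg_zero]
  -- numerator: one-sided convexity tail with floor `R` on `[b, a]`
  have hsub : Icc b a ⊆ Ioi (0 : ℝ) := fun u hu => lt_of_lt_of_le hb0 hu.1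
  have hfloorR : ∀ x ∈ Icc b a, R ≤ g₂ x := by
    intro x hx
    have hx0 : 0 < x := hsub hx
    have h1 := xi_curvature_lower k hx0
    have h2 : Real.exp (4 * (a - τ)) ≤ Real.exp (4 * x) := Real.exp_le_exp.2 (by rw [← hb]; linarith [hx.1])
    have hπ : 0 < 16 * Real.pi := by positivity
    have h3 := mul_le_mul_of_nonneg_left h2 hπ.le
    simp only [hg₂]; linarith
  have hnum := setIntegral_exp_neg_le_of_curvature_floor (D := Ioi 0) (S := Ioo 0 b) (g := g)
    (g₁ := g₁) (g₂ := g₂) hba hR0 (convexOn_W k) hsub (fun x hx => hasDerivAt_W k (hsub hx))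
    (fun x hx => hasDerivAt_W' k (hsub hx)) hfloorR hga
    (fun u hu => ⟨Ioo_subset_Ioi_self hu, hu.2⟩) measurableSet_Ioo
  have hnum' : ∫ u in Ioo 0 b, deBruijnPhi u * u ^ k ≤
      deBruijnPhi a * a ^ k * Real.exp (-(R * τ ^ 2 / 2)) / (R * τ) := by
    have e1 : ∫ u in Ioo 0 b, Real.exp (-g u) = ∫ u in Ioo 0 b, deBruijnPhi u * u ^ k :=
      setIntegral_congr_fun measurableSet_Ioo fun u hu => exp_neg_W k hu.1
    have e2 : Real.exp (-g a) = deBruijnPhi a * a ^ k := exp_neg_W k ha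
    have e3 : a - b = τ := by rw [hb]; ring
    rw [e1, e2, e3] at hnum
    exact hnum
  -- denominator: the window normaliser with ceiling `Λ` on `[a − s, a + s]`
  have hceil : ∀ u ∈ Icc (a - s) (a + s), g₂ u ≤ Λ := by
    intro u hu
    have hu0 : 0 < u := by linarith [hu.1]
    have hu32 : (3 : ℝ) / 2 ≤ u := le_trans has hu.1
    have hV := deBruijnPhi_logConcave_upper_div hu32
    have h1 : (k : ℝ) / u ^ 2 ≤ (k : ℝ) / (a - s) ^ 2 :=
      div_le_div_of_nonneg_left (Nat.cast_nonneg k) (by positivity) (pow_le_pow_left₀ (by linarith) hu.1 2)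
    have h2 : Real.exp (4 * u) ≤ Real.exp (4 * (a + s)) := Real.exp_le_exp.2 (by linarith [hu.2])
    have hπ : 0 ≤ 16 * Real.pi * (1 + 1 / 10 ^ 6) := by positivity
    have h3 := mul_le_mul_of_nonneg_left h2 hπ
    simp only [hg₂, hΛ]
    nlinarith
  have hden := xiMoment_ge_window k hs hsa hmode hceil
  have hden0 : 0 < 2 * s * (deBruijnPhi a * a ^ k * Real.exp (-(Λ * s ^ 2 / 2))) := by
    have := deBruijnPhi_pos_holds a; positivity
  have hM := xiMoment_pos k
  have hN0 : 0 ≤ ∫ u in Ioo 0 b, deBruijnPhi u * u ^ k :=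
    setIntegral_nonneg measurableSet_Ioo fun u hu =>
      (mul_pos (deBruijnPhi_pos_holds u) (pow_pos hu.1 k)).le
  -- combine
  calc (∫ u in Ioo 0 b, deBruijnPhi u * u ^ k) / xiMoment k
      ≤ (deBruijnPhi a * a ^ k * Real.exp (-(R * τ ^ 2 / 2)) / (R * τ)) /
          (2 * s * (deBruijnPhi a * a ^ k * Real.exp (-(Λ * s ^ 2 / 2)))) :=
        div_le_div₀ (by have := deBruijnPhi_pos_holds a; positivity) hnum' hden0 hden
    _ = Real.exp (-(R * τ ^ 2 / 2)) * Real.exp (Λ * s ^ 2 / 2) / (2 * s * R * τ) := by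
        have hΦa : deBruijnPhi a * a ^ k ≠ 0 := (mul_pos (deBruijnPhi_pos_holds a) (pow_pos ha k)).ne'
        have he : Real.exp (-(Λ * s ^ 2 / 2)) * Real.exp (Λ * s ^ 2 / 2) = 1 := by
          rw [← Real.exp_add]; simp
        field_simp
        rw [div_self (deBruijnPhi_pos_holds a).ne', ← Real.exp_add, neg_add_cancel, Real.exp_zero]

end Literature.NumberTheory.LFunctions
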